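import Summits.AtomisticToContinuum.HydrodynamicLimit.Theses.VitaliAmplitudeTransfer
import Summits.AtomisticToContinuum.HydrodynamicLimit.Theorems.VitaliAmplitudeTransferAmplitudeTransferEquiLipschitz
import Summits.AtomisticToContinuum.HydrodynamicLimit.Theorems.VitaliAmplitudeTransferAmplitudeTransferPathConstruction

/-!
# Route VitaliAmplitudeTransfer — the guarded transfer `AmplitudeTransferR` (item stmt-AtomisticToContinuum-17807)

`UniformAmplitudeAnalyticity → NearEquilibriumLimit → FieldVarianceBound → AnalyticPreShockPathsR →
LocalGibbsStatics → _root_.HydrodynamicLimit`: the glue of the deciding theorem `closes` of route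
`VitaliAmplitudeTransfer` after the 2026-08-16 re-type of the sub-problem Statement (the
PACKING-GUARDED hydrodynamic limit, `∃ η₀ > 0, … (∀ t ∈ [0,T), ∀ x, ρ_t(x) σ³ < η₀) → …`).

The proof is that of `amplitudeTransfer_proof` (Theorems/VitaliAmplitudeTransferAmplitudeTransfer,
item stmt-AtomisticToContinuum-11875; its helper modules are reused unchanged) with the packing
guard threaded through: the threshold `η₀` of `AnalyticPreShockPathsR` (C′) is offered as the
Statement's `η₀`, the Statement's guard hypothesis is introduced, and it is handed verbatim to C′.
The five steps are otherwise identical.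

1. Identification of the data (`slices_eq_of_tendstoHydroFieldsAt`): the LLN of `LocalGibbsStatics`
   and the LLN hypothesis pin `ρ(0) = R(e^μ a₀)`, `u(0) = u₀`, `θ(0) = θ₀`; bounds `4B₀²`, unit mass.
2. The path `a_δ = e^{-μ} Rinv(ρ^δ(0))`, `θ_δ = θ^δ(0)`, `u_δ = u^δ(0)` along the pre-shock family
   of `AnalyticPreShockPathsR` (available because the solution obeys the packing guard): within
   `32B₀³`, analytic on `[0,1)`, `C¹` on `[0,1]`, constant at `0`, LLN-matched for every `δ`
   (uniqueness of the chemical potential), and equal to `(a₀, u₀, θ₀)` at `δ = 1`.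
3. Vitali on sub-paths `δ ↦ δ₂δ` (`UniformAmplitudeAnalyticity`, `NearEquilibriumLimit`, mean
   convergence from `FieldVarianceBound`, library Vitali–Porter and identity theorem).
4. Equi-Lipschitz means (`d/dδ E = (N+1) Cov`, `FieldVarianceBound` at times `t` and `0`) and the
   endpoint `δ = 1`.
5. Chebyshev (`FieldVarianceBound` at `δ = 1`), coordinatewise for the momentum field.
-/

noncomputable section

open MeasureTheory ProbabilityTheory Filter Set Topology
open scoped ENNReal

namespace Summit.AtomisticToContinuum.HydrodynamicLimit.Theorems

open Literature.MathematicalPhysics.KineticTheory Literature.Analysis.FluidPDE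
open Literature.Analysis.FunctionSpaces
open Summit.AtomisticToContinuum.HydrodynamicLimit.Theses.VitaliAmplitudeTransfer
open Summit.AtomisticToContinuum.HydrodynamicLimit.Theorems.AmplitudeTransfer

/-- **The guarded amplitude transfer** (route `VitaliAmplitudeTransfer`, item `AmplitudeTransferR`):
N-uniform amplitude analyticity, the near-equilibrium limit, CLT-size field variances, the
packing-guarded analytic pre-shock paths and the local Gibbs statics imply the packing-guarded
hydrodynamic limit of hard spheres (`_root_.HydrodynamicLimit`, the sub-problem Statement), by
Vitali's theorem in the tilt amplitude; the packing threshold is the one of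
`AnalyticPreShockPathsR`. -/
theorem amplitudeTransferR_proof :
    Summit.AtomisticToContinuum.HydrodynamicLimit.Theses.VitaliAmplitudeTransfer.AmplitudeTransferR := by
  unfold Summit.AtomisticToContinuum.HydrodynamicLimit.Theses.VitaliAmplitudeTransfer.AmplitudeTransferR
  intro hA hB hV hCR hS
  unfold _root_.HydrodynamicLimit
  /- the packing threshold of C′ is the Statement's -/
  obtain ⟨η₀, hη₀, hC⟩ := hCR
  refine ⟨η₀, hη₀, ?_⟩
  intro a₀ θ₀ u₀ ha hθ hu ha0 hθ0
  /- bounds of the profiles and the derived bound parameters -/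
  obtain ⟨B₀, hB₀, hbd₀⟩ := exists_bounds_of_continuous_pos ha hθ hu ha0 hθ0
  have hB₀0 : 0 < B₀ := by linarith
  set B₁ : ℝ := 4 * B₀ ^ 2 with hB₁def
  set Bs : ℝ := 32 * B₀ ^ 3 with hBsdef
  have hB₁ : 1 ≤ B₁ := by rw [hB₁def]; nlinarith
  have hBs : 1 ≤ Bs := by rw [hBsdef]; nlinarith [one_le_pow₀ (n := 3) hB₀]
  have hB₀B₁ : B₀ ≤ B₁ := by rw [hB₁def]; nlinarith
  have hB₁Bs : 2 * B₁ ≤ Bs := by rw [hB₁def, hBsdef]; nlinarith [one_le_pow₀ (n := 2) hB₀]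
  have hB₀Bs : B₀ ≤ Bs := by linarith
  obtain ⟨σS, hσS, hS'⟩ := hS Bs hBs
  obtain ⟨σC, hσC, hC'⟩ := hC B₁ hB₁
  obtain ⟨σA, hσA, hA'⟩ := hA Bs hBs
  obtain ⟨σB, hσB, hB'⟩ := hB Bs hBs
  obtain ⟨σV, hσV, hV'⟩ := hV Bs hBs
  refine ⟨min σS (min σC (min σA (min σB σV))),
    lt_min hσS (lt_min hσC (lt_min hσA (lt_min hσB hσV))), fun σ hσ hσlt => ?_⟩
  have hσS' : σ < σS := lt_of_lt_of_le hσlt (min_le_left _ _)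
  have hσC' : σ < σC := lt_of_lt_of_le hσlt ((min_le_right _ _).trans (min_le_left _ _))
  have hσA' : σ < σA :=
    lt_of_lt_of_le hσlt ((min_le_right _ _).trans ((min_le_right _ _).trans (min_le_left _ _)))
  have hσB' : σ < σB := lt_of_lt_of_le hσlt ((min_le_right _ _).trans ((min_le_right _ _).trans
    ((min_le_right _ _).trans (min_le_left _ _))))
  have hσV' : σ < σV := lt_of_lt_of_le hσlt ((min_le_right _ _).trans ((min_le_right _ _).trans
    ((min_le_right _ _).trans (min_le_right _ _))))
  intro T ρ θ u hsol hguard Φ hLLN t ht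
  have hT : 0 < T := lt_of_le_of_lt ht.1 ht.2
  have h0T : (0 : ℝ) ∈ Ico 0 T := ⟨le_rfl, hT⟩
  /- the local Gibbs statics at bound `Bs` -/
  obtain ⟨R, Rinv, hRan, hRinvan, hRmono, -, hRprop, hRinvprop, hSprof⟩ := hS' σ hσ hσS'
  have hRc : ContinuousOn R (Icc 0 (4 * Bs ^ 2)) := hRan.continuousOn
  have hRinvc : ContinuousOn Rinv (Icc 0 (4 * Bs ^ 2)) := hRinvan.continuousOn
  have hRcmp : ∀ z ∈ Icc (0 : ℝ) (4 * Bs ^ 2), z / 2 ≤ R z ∧ R z ≤ 2 * z :=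
    fun z hz => ⟨(hRprop z hz).2.1, (hRprop z hz).2.2⟩
  have hbd₀s : ∀ x, Bs⁻¹ ≤ a₀ x ∧ a₀ x ≤ Bs ∧ Bs⁻¹ ≤ θ₀ x ∧ θ₀ x ≤ Bs ∧ ‖u₀ x‖ ≤ Bs := by
    intro x
    obtain ⟨h1, h2, h3, h4, h5⟩ := hbd₀ x
    have hi : Bs⁻¹ ≤ B₀⁻¹ := by rw [inv_le_inv₀ (by linarith) hB₀0]; exact hB₀Bs
    exact ⟨hi.trans h1, h2.trans hB₀Bs, hi.trans h3, h4.trans hB₀Bs, h5.trans hB₀Bs⟩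
  obtain ⟨μ, hmass, hrange, hSΦ⟩ := hSprof a₀ θ₀ u₀ ha hθ hu hbd₀s
  obtain ⟨hprob₀, hLLN'⟩ := hSΦ Φ
  /- step (1): identification of the data at time `0` -/
  obtain ⟨hρ0c, hu0c, hθ0c⟩ := continuous_slices_of_isHardSphereEulerSolution hsol h0T
  have hRa₀c : Continuous fun x => R (Real.exp μ * a₀ x) :=
    hRc.comp_continuous (continuous_const.mul ha) hrange
  haveI : ∀ N, IsProbabilityMeasure ((fun N => localGibbsLaw σ a₀ u₀ θ₀ N (Φ N)) N) := hprob₀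
  obtain ⟨hρ0eq, hu0eq, hθ0eq⟩ := slices_eq_of_tendstoHydroFieldsAt hLLN hLLN' hρ0c hu0c hθ0c
    hRa₀c hu hθ (hsol.density_pos 0 h0T)
  -- `hρ0eq : ρ 0 = fun x => R (exp μ * a₀ x)`, `hu0eq : u 0 = u₀`, `hθ0eq : θ 0 = θ₀`
  obtain ⟨hexpl, hexpu⟩ := exp_mu_bounds hB₀ hRcmp hRc ha (fun x => ⟨(hbd₀ x).1, (hbd₀ x).2.1⟩)
    hrange hmass
  have hdata : ∀ x, B₁⁻¹ ≤ ρ 0 x ∧ ρ 0 x ≤ B₁ ∧ B₁⁻¹ ≤ θ 0 x ∧ θ 0 x ≤ B₁ ∧ ‖u 0 x‖ ≤ B₁ := by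
    intro x
    have hi : B₁⁻¹ ≤ B₀⁻¹ := by rw [inv_le_inv₀ (by linarith) hB₀0]; exact hB₀B₁
    obtain ⟨h1, h2⟩ := R_value_bounds hB₀ hRcmp ⟨hexpl, hexpu⟩ ⟨(hbd₀ x).1, (hbd₀ x).2.1⟩ (hrange x)
    rw [hρ0eq, hu0eq, hθ0eq]
    exact ⟨h1, h2, hi.trans (hbd₀ x).2.2.1, (hbd₀ x).2.2.2.1.trans hB₀B₁,
      (hbd₀ x).2.2.2.2.trans hB₀B₁⟩
  have hmass1 : ∫ x, ρ 0 x = 1 := by rw [hρ0eq]; exact hmass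
  /- step (2): the pre-shock family (C′, the guard handed over verbatim) and the path -/
  obtain ⟨T', htT', hT'T, ρE, θE, uE, hEsol, hE1, hE0, hEdata, hEanρ, hEanθ, hEanu, hEtest,
    hEC1ρ, hEC1θ, hEC1u⟩ := hC' σ hσ hσC' T ρ θ u hsol hguard hdata hmass1 t ht
  have hT' : 0 < T' := lt_of_le_of_lt ht.1 htT'
  have h0T' : (0 : ℝ) ∈ Ico 0 T' := ⟨le_rfl, hT'⟩
  have htT'' : t ∈ Ico 0 T' := ⟨ht.1, htT'⟩
  -- continuity of the family slices
  have hEc : ∀ δ ∈ Icc (0 : ℝ) 1, ∀ s ∈ Ico 0 T',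
      Continuous (ρE δ s) ∧ Continuous (uE δ s) ∧ Continuous (θE δ s) :=
    fun δ hδ s hs => continuous_slices_of_isHardSphereEulerSolution (hEsol δ hδ) hs
  -- the path
  set a : ℝ → T3 → ℝ := fun δ x => Real.exp (-μ) * Rinv (ρE δ 0 x) with hadef
  set θp : ℝ → T3 → ℝ := fun δ x => θE δ 0 x with hθpdef
  set up : ℝ → T3 → V3 := fun δ x => uE δ 0 x with hupdef
  have hexpneg : (2 * B₀)⁻¹ ≤ Real.exp (-μ) ∧ Real.exp (-μ) ≤ 2 * B₀ := by
    rw [Real.exp_neg]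
    constructor
    · rw [inv_le_inv₀ (by positivity) (Real.exp_pos μ)]; exact hexpu
    · rw [inv_le_comm₀ (Real.exp_pos μ) (by positivity)]; exact hexpl
  have hRinvcmp : ∀ y ∈ Icc (0 : ℝ) (2 * (32 * B₀ ^ 3)), y / 2 ≤ Rinv y ∧ Rinv y ≤ 2 * y :=
    fun y hy => ⟨(hRinvprop y hy).2.1, (hRinvprop y hy).2.2⟩
  -- (P1) bounds along the path
  have hP1 : ∀ δ ∈ Icc (0 : ℝ) 1, ∀ x,
      Bs⁻¹ ≤ a δ x ∧ a δ x ≤ Bs ∧ Bs⁻¹ ≤ θp δ x ∧ θp δ x ≤ Bs ∧ ‖up δ x‖ ≤ Bs := by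
    intro δ hδ x
    obtain ⟨h1, h2, h3, h4, h5⟩ := (hEdata δ hδ).2 x
    obtain ⟨ha1, ha2⟩ := path_value_bounds hB₀ hRinvcmp hexpneg ⟨h1, h2⟩
    have hi : Bs⁻¹ ≤ (2 * B₁)⁻¹ := by rw [inv_le_inv₀ (by linarith) (by positivity)]; exact hB₁Bs
    exact ⟨ha1, ha2, hi.trans h3, h4.trans hB₁Bs, h5.trans hB₁Bs⟩
  -- family data lie in the domains of `Rinv` and `R`
  have hρEmem : ∀ δ ∈ Icc (0 : ℝ) 1, ∀ x, ρE δ 0 x ∈ Icc (0 : ℝ) (4 * Bs ^ 2) := by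
    intro δ hδ x
    obtain ⟨h1, h2, -⟩ := (hEdata δ hδ).2 x
    exact ⟨le_trans (by positivity) h1, h2.trans (by nlinarith)⟩
  have hρEmem' : ∀ δ ∈ Icc (0 : ℝ) 1, ∀ x, ρE δ 0 x ∈ Icc (0 : ℝ) (2 * Bs) := by
    intro δ hδ x
    obtain ⟨h1, h2, -⟩ := (hEdata δ hδ).2 x
    exact ⟨le_trans (by positivity) h1, h2.trans (hB₁Bs.trans (by linarith))⟩
  -- (P2) analyticity on `[0,1) × ℝ³`
  have hP2a : AnalyticOnNhd ℝ (Torus.stLift a) (Ico 0 1 ×ˢ univ) :=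
    analyticOnNhd_stLift_comp hRinvan hEanρ (fun δ hδ x => hρEmem δ (Ico_subset_Icc_self hδ) x) _
  -- (P3) `C¹` on `[0,1] × ℝ³`
  have h0t : (0 : ℝ) ∈ Icc 0 t := ⟨le_rfl, ht.1⟩
  have hP3ρ : ContDiffOn ℝ 1 (Torus.stLift fun δ => ρE δ 0) (Icc 0 1 ×ˢ univ) :=
    contDiffOn_stLift_slice h0t hEC1ρ
  have hP3a : ContDiffOn ℝ 1 (Torus.stLift a) (Icc 0 1 ×ˢ univ) :=
    contDiffOn_stLift_comp (hRinvan.contDiffOn_of_completeSpace) hP3ρ (fun δ hδ x => hρEmem δ hδ x) _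
  have hP3θ : ContDiffOn ℝ 1 (Torus.stLift θp) (Icc 0 1 ×ˢ univ) := contDiffOn_stLift_slice h0t hEC1θ
  have hP3u : ContDiffOn ℝ 1 (Torus.stLift up) (Icc 0 1 ×ˢ univ) := contDiffOn_stLift_slice h0t hEC1u
  have hPc : ∀ δ ∈ Icc (0 : ℝ) 1, Continuous (a δ) ∧ Continuous (θp δ) ∧ Continuous (up δ) :=
    fun δ hδ => ⟨continuous_slice_of_continuousOn_stLift hP3a.continuousOn hδ,
      continuous_slice_of_continuousOn_stLift hP3θ.continuousOn hδ,
      continuous_slice_of_continuousOn_stLift hP3u.continuousOn hδ⟩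
  -- (P4) constant profiles at `δ = 0`
  have hP4 : ∀ x y, a 0 x = a 0 y ∧ θp 0 x = θp 0 y ∧ up 0 x = up 0 y := by
    intro x y
    obtain ⟨h1, h2, h3⟩ := hE0 x y
    simp only [hadef, hθpdef, hupdef, h1, h2, h3, and_self]
  -- (P5) the path is LLN-matched to the family, with probability laws
  have hP5 : ∀ δ ∈ Icc (0 : ℝ) 1,
      (∀ N, IsProbabilityMeasure (localGibbsLaw σ (a δ) (up δ) (θp δ) N (Φ N))) ∧
      TendstoHydroFieldsAt (fun N => localGibbsLaw σ (a δ) (up δ) (θp δ) N (Φ N)) Φ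
        (ρE δ) (uE δ) (θE δ) 0 := by
    intro δ hδ
    obtain ⟨μ', hmass', hrange', hSΦ'⟩ := hSprof (a δ) (θp δ) (up δ) (hPc δ hδ).1 (hPc δ hδ).2.1
      (hPc δ hδ).2.2 (hP1 δ hδ)
    obtain ⟨hprob', hLLN''⟩ := hSΦ' Φ
    refine ⟨hprob', ?_⟩
    -- `R (e^μ a δ x) = ρE δ 0 x`
    have hRa : ∀ x, R (Real.exp μ * a δ x) = ρE δ 0 x := by
      intro x
      have : Real.exp μ * a δ x = Rinv (ρE δ 0 x) := by
        simp only [hadef]; rw [← mul_assoc, ← Real.exp_add, add_neg_cancel, Real.exp_zero, one_mul]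
      rw [this]
      exact (hRinvprop _ (hρEmem' δ hδ x)).1
    -- uniqueness of the chemical potential
    have ha0' : ∀ x, 0 < a δ x := fun x => lt_of_lt_of_le (by positivity) (hP1 δ hδ x).1
    have hmem2 : ∀ x, Real.exp μ * a δ x ∈ Icc (0 : ℝ) (4 * Bs ^ 2) := by
      intro x
      have : Real.exp μ * a δ x = Rinv (ρE δ 0 x) := by
        simp only [hadef]; rw [← mul_assoc, ← Real.exp_add, add_neg_cancel, Real.exp_zero, one_mul]
      rw [this]
      obtain ⟨-, h1, h2⟩ := hRinvprop _ (hρEmem' δ hδ x)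
      obtain ⟨hl, hr⟩ := hρEmem' δ hδ x
      exact ⟨le_trans (by linarith) h1, h2.trans (by nlinarith)⟩
    have hint : ∫ x, R (Real.exp μ' * a δ x) = ∫ x, R (Real.exp μ * a δ x) := by
      rw [hmass']
      simp_rw [hRa]
      exact (hEdata δ hδ).1.symm
    have heq := R_comp_eq_of_integral_eq hRmono hRc (hPc δ hδ).1 ha0' hrange' hmem2 hint
    refine tendstoHydroFieldsAt_congr (h := hLLN'') ?_ ?_ ?_
    · funext x
      show R (Real.exp μ' * a δ x) = ρE δ 0 x
      rw [heq x, hRa x]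
    · funext x; rfl
    · funext x; rfl
  -- (P6) the endpoint of the path is the given datum
  have hP6 : a 1 = a₀ ∧ up 1 = u₀ ∧ θp 1 = θ₀ := by
    obtain ⟨hρ1, hu1, hθ1⟩ := hE1 0 h0T'
    refine ⟨?_, ?_, ?_⟩
    · funext x
      simp only [hadef]
      rw [hρ1, hρ0eq]
      simp only
      rw [(hRprop _ (hrange x)).1, ← mul_assoc, ← Real.exp_add, neg_add_cancel, Real.exp_zero,
        one_mul]
    · funext x; simp only [hupdef]; rw [hu1, hu0eq]
    · funext x; simp only [hθpdef]; rw [hθ1, hθ0eq]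
  have h1I : (1 : ℝ) ∈ Icc (0 : ℝ) 1 := ⟨zero_le_one, le_rfl⟩
  /- sub-path frames, for `δ₂ ∈ (0, 1)` -/
  have hsub : ∀ δ₂ ∈ Ioo (0 : ℝ) 1,
      AnalyticOnNhd ℝ (Torus.stLift fun δ => a (δ₂ * δ)) (Icc 0 1 ×ˢ univ) ∧
      AnalyticOnNhd ℝ (Torus.stLift fun δ => θp (δ₂ * δ)) (Icc 0 1 ×ˢ univ) ∧
      AnalyticOnNhd ℝ (Torus.stLift fun δ => up (δ₂ * δ)) (Icc 0 1 ×ˢ univ) ∧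
      (∀ δ ∈ Icc (0 : ℝ) 1, ∀ x, Bs⁻¹ ≤ a (δ₂ * δ) x ∧ a (δ₂ * δ) x ≤ Bs ∧
        Bs⁻¹ ≤ θp (δ₂ * δ) x ∧ θp (δ₂ * δ) x ≤ Bs ∧ ‖up (δ₂ * δ) x‖ ≤ Bs) ∧
      (∀ x y, a (δ₂ * 0) x = a (δ₂ * 0) y ∧ θp (δ₂ * 0) x = θp (δ₂ * 0) y ∧
        up (δ₂ * 0) x = up (δ₂ * 0) y) ∧
      (∀ δ ∈ Icc (0 : ℝ) 1, IsHardSphereEulerSolution σ T' (ρE (δ₂ * δ)) (uE (δ₂ * δ)) (θE (δ₂ * δ))) ∧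
      (∀ δ ∈ Icc (0 : ℝ) 1,
        (∀ N, IsProbabilityMeasure (localGibbsLaw σ (a (δ₂ * δ)) (up (δ₂ * δ)) (θp (δ₂ * δ)) N (Φ N))) ∧
        TendstoHydroFieldsAt (fun N => localGibbsLaw σ (a (δ₂ * δ)) (up (δ₂ * δ)) (θp (δ₂ * δ)) N (Φ N)) Φ
          (ρE (δ₂ * δ)) (uE (δ₂ * δ)) (θE (δ₂ * δ)) 0) := by
    intro δ₂ hδ₂
    have hδ₂' : δ₂ ∈ Ico (0 : ℝ) 1 := ⟨hδ₂.1.le, hδ₂.2⟩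
    have hmemI : ∀ δ ∈ Icc (0 : ℝ) 1, δ₂ * δ ∈ Icc (0 : ℝ) 1 := fun δ hδ =>
      ⟨mul_nonneg hδ₂.1.le hδ.1, by nlinarith [hδ₂.2, hδ.2, hδ₂.1, hδ.1]⟩
    refine ⟨analyticOnNhd_stLift_subpath hP2a hδ₂', analyticOnNhd_stLift_subpath hEanθ hδ₂',
      analyticOnNhd_stLift_subpath hEanu hδ₂', fun δ hδ x => hP1 _ (hmemI δ hδ) x, ?_,
      fun δ hδ => hEsol _ (hmemI δ hδ), fun δ hδ => hP5 _ (hmemI δ hδ)⟩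
    intro x y
    simp only [mul_zero]
    exact hP4 x y
  /- steps (3)–(5) for one scalar observable, at the endpoint profiles `(a₀, u₀, θ₀)` -/
  have scalar : ∀ (w : T3 × V3 → ℝ), Continuous w → ∀ Cw : ℝ, (∀ y, |w y| ≤ Cw * (1 + ‖y.2‖ ^ 2)) →
      ∀ e : ℝ → ℝ, AnalyticOnNhd ℝ e (Ico 0 1) → ContinuousWithinAt e (Icc 0 1) 1 →
      (∀ δ ∈ Icc (0 : ℝ) 1, TendstoHydroFieldsAt
          (fun N => localGibbsLaw σ (a δ) (up δ) (θp δ) N (Φ N)) Φ (ρE δ) (uE δ) (θE δ) t →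
        ∀ η > (0 : ℝ), Tendsto (fun N => localGibbsLaw σ (a δ) (up δ) (θp δ) N (Φ N)
          {z | η < |(∫ y, w y ∂(empiricalMeasure ((Φ N).flow t z))) - e δ|}) atTop (𝓝 0)) →
      ∀ η > (0 : ℝ), Tendsto (fun N => localGibbsLaw σ a₀ u₀ θ₀ N (Φ N)
          {z | η < |(∫ y, w y ∂(empiricalMeasure ((Φ N).flow t z))) - e 1|}) atTop (𝓝 0) := by
    intro w hw Cw hwb e he he1 hprobE η hη
    have h := tendsto_scalar_at_one hBs htT'' (hA' σ hσ hσA') (hB' σ hσ hσB') (hV' σ hσ hσV') hP1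
      hP3a hP3θ hP3u hEsol hP5 hEC1ρ hEC1θ hEC1u hsub hw hwb he he1 hprobE hη
    rwa [hP6.1, hP6.2.1, hP6.2.2] at h
  /- the five scalar observables -/
  obtain ⟨hρtc, hutc, hθtc⟩ := continuous_slices_of_isHardSphereEulerSolution hsol ht
  have hEtc : ∀ δ ∈ Icc (0 : ℝ) 1, Continuous (ρE δ t) ∧ Continuous (uE δ t) ∧ Continuous (θE δ t) :=
    fun δ hδ => hEc δ hδ t htT''
  obtain ⟨hE1ρ, hE1u, hE1θ⟩ := hE1 t htT''
  have htt : t ∈ Icc (0 : ℝ) t := ⟨ht.1, le_rfl⟩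
  have hLρ : ContinuousOn (Torus.stLift fun δ => ρE δ t) (Icc 0 1 ×ˢ univ) :=
    (contDiffOn_stLift_slice htt hEC1ρ).continuousOn
  have hLu : ContinuousOn (Torus.stLift fun δ => uE δ t) (Icc 0 1 ×ˢ univ) :=
    (contDiffOn_stLift_slice htt hEC1u).continuousOn
  have hLθ : ContinuousOn (Torus.stLift fun δ => θE δ t) (Icc 0 1 ×ˢ univ) :=
    (contDiffOn_stLift_slice htt hEC1θ).continuousOn
  refine tendstoHydroFieldsAt_of_prob_scalars hρtc hutc (fun χ hχ η hη => ?_)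
    (fun χ hχ l η hη => ?_) (fun χ hχ η hη => ?_)
  · -- density
    obtain ⟨Cχ, hCχ0, hCχ⟩ := exists_forall_abs_le_of_continuous hχ
    have h := scalar (fun y => χ y.1) (hχ.comp continuous_fst) Cχ
      (fun y => (hCχ y.1).trans (le_mul_of_one_le_right hCχ0
        (by have h0 := sq_nonneg ‖y.2‖; linarith)))
      (fun δ => ∫ x, χ x * ρE δ t x) (hEtest t htT'' χ hχ).1
      ((continuousOn_integral_mul_of_continuousOn_stLift hLρ hχ).continuousWithinAt h1I)
      (fun δ hδ hTH η' hη' => (prob_scalars_of_tendstoHydroFieldsAt hTH (hEtc δ hδ).1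
        (hEtc δ hδ).2.1 hχ hη').1) η hη
    simpa only [hE1ρ] using h
  · -- momentum, coordinate `l`
    obtain ⟨Cχ, hCχ0, hCχ⟩ := exists_forall_abs_le_of_continuous hχ
    have hwb : ∀ y : T3 × V3, |χ y.1 * y.2 l| ≤ Cχ * (1 + ‖y.2‖ ^ 2) := by
      intro y
      rw [abs_mul]
      have h1 : |y.2 l| ≤ ‖y.2‖ := by
        simpa [Real.norm_eq_abs] using PiLp.norm_apply_le y.2 l
      have h2' : ∀ r : ℝ, r ≤ 1 + r ^ 2 := fun r => by nlinarith [sq_nonneg (r - 1 / 2)]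
      have h2 : ‖y.2‖ ≤ 1 + ‖y.2‖ ^ 2 := h2' _
      exact mul_le_mul (hCχ y.1) (h1.trans h2) (abs_nonneg _) hCχ0
    have hcont_e : ContinuousOn (fun δ => ∫ x, χ x * (ρE δ t x * uE δ t x l)) (Icc 0 1) := by
      refine continuousOn_integral_mul_of_continuousOn_stLift (f := fun δ x => ρE δ t x * uE δ t x l) ?_ hχ
      have h1 : ContinuousOn (fun p : ℝ × EuclideanSpace ℝ (Fin 3) =>
          Torus.stLift (fun δ => ρE δ t) p * (Torus.stLift (fun δ => uE δ t) p) l) (Icc 0 1 ×ˢ univ) :=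
        hLρ.mul ((EuclideanSpace.proj (𝕜 := ℝ) l).continuous.comp_continuousOn hLu)
      refine h1.congr fun p _ => ?_
      obtain ⟨s, y⟩ := p
      simp only [Torus.stLift_apply]
    have hcont_e' : ContinuousOn (fun δ => ∫ x, χ x * ρE δ t x * uE δ t x l) (Icc 0 1) :=
      hcont_e.congr fun δ _ => by simp only [mul_assoc]
    have he_eq : ∀ δ ∈ Icc (0 : ℝ) 1,
        (∫ x, (χ x * ρE δ t x) • uE δ t x) l = ∫ x, χ x * ρE δ t x * uE δ t x l :=
      fun δ hδ => integral_smul_apply hχ (hEtc δ hδ).1 (hEtc δ hδ).2.1 l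
    have h := scalar (fun y => χ y.1 * y.2 l) ((hχ.comp continuous_fst).mul
        ((EuclideanSpace.proj (𝕜 := ℝ) l).continuous.comp continuous_snd)) Cχ hwb
      (fun δ => (∫ x, (χ x * ρE δ t x) • uE δ t x) l)
      (fun δ hδ => ((EuclideanSpace.proj (𝕜 := ℝ) l).analyticAt _).comp ((hEtest t htT'' χ hχ).2.1 δ hδ))
      ((hcont_e'.continuousWithinAt h1I).congr (fun δ hδ => he_eq δ hδ) (he_eq 1 h1I))
      (fun δ hδ hTH η' hη' => by
        have hp := (prob_scalars_of_tendstoHydroFieldsAt hTH (hEtc δ hδ).1 (hEtc δ hδ).2.1 hχ hη').2.1 l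
        simpa only [he_eq δ hδ] using hp) η hη
    rw [he_eq 1 h1I] at h
    simpa only [hE1ρ, hE1u] using h
  · -- energy
    obtain ⟨Cχ, hCχ0, hCχ⟩ := exists_forall_abs_le_of_continuous hχ
    have hwb : ∀ y : T3 × V3, |χ y.1 * (‖y.2‖ ^ 2 / 2)| ≤ Cχ * (1 + ‖y.2‖ ^ 2) := by
      intro y
      have h0 := sq_nonneg ‖y.2‖
      rw [abs_mul, abs_of_nonneg (by linarith : (0 : ℝ) ≤ ‖y.2‖ ^ 2 / 2)]
      exact mul_le_mul (hCχ y.1) (by linarith) (by linarith) hCχ0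
    have hcont_e : ContinuousOn (fun δ => ∫ x, χ x *
        totalEnergyDensity (ρE δ t x) (uE δ t x) (θE δ t x)) (Icc 0 1) := by
      refine continuousOn_integral_mul_of_continuousOn_stLift
        (f := fun δ x => totalEnergyDensity (ρE δ t x) (uE δ t x) (θE δ t x)) ?_ hχ
      have h1 : ContinuousOn (fun p : ℝ × EuclideanSpace ℝ (Fin 3) =>
          totalEnergyDensity (Torus.stLift (fun δ => ρE δ t) p) (Torus.stLift (fun δ => uE δ t) p)
            (Torus.stLift (fun δ => θE δ t) p)) (Icc 0 1 ×ˢ univ) := by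
        unfold totalEnergyDensity
        exact hLρ.mul (((hLu.norm.pow 2).div_const 2).add (continuousOn_const.mul hLθ))
      refine h1.congr fun p _ => ?_
      obtain ⟨s, y⟩ := p
      simp only [Torus.stLift_apply]
    have h := scalar (fun y => χ y.1 * (‖y.2‖ ^ 2 / 2)) ((hχ.comp continuous_fst).mul
        ((continuous_snd.norm.pow 2).div_const 2)) Cχ hwb
      (fun δ => ∫ x, χ x * totalEnergyDensity (ρE δ t x) (uE δ t x) (θE δ t x))
      (hEtest t htT'' χ hχ).2.2 (hcont_e.continuousWithinAt h1I)
      (fun δ hδ hTH η' hη' => (prob_scalars_of_tendstoHydroFieldsAt hTH (hEtc δ hδ).1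
        (hEtc δ hδ).2.1 hχ hη').2.2) η hη
    simpa only [hE1ρ, hE1u, hE1θ] using h

end Summit.AtomisticToContinuum.HydrodynamicLimit.Theorems

end
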